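import Mathlib
import Summits.QuantumAdvantage.QuantumAdvantage.Theorems.MobiusLadderQuadraticDigitPhasesStubCompactLemmas

/-!
# The mixed second difference of a quadratic digit polynomial (stub `stub_evalAddAdd`)

The stub `stub_evalAddAdd` of the crux `MobiusLadder.QuadraticDigitPhases`
(stmt-QuantumAdvantage-1391), line `Sketch`.

For a polynomial `P` of total degree `≤ 2` over `𝔽₂` in the bit variables `x₀, …, x_{n-1}` and bit
vectors `y, δ`,
`P(y + δ) + P(y) + P(δ) + P(0) = Σ_{i<j} a_{ij} (yᵢ δⱼ + δᵢ yⱼ)`,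
where `a_{ij}` is the coefficient of `Xᵢ Xⱼ` in `P`: the constant term appears four times, the linear
and the square terms are additive in characteristic `2`, and only the cross terms survive, through
their symmetric bilinear form.  Elementary (folklore); the proof evaluates the normal form
`eval_eq_of_totalDegree_le_two` of the compactness lemmas (every vector over `𝔽₂` is idempotent) at
the four points and compares term by term.
-/

set_option linter.dupNamespace false -- D-0017: single-problem summit ⇒ QuantumAdvantage.QuantumAdvantage by design

namespace Summit.QuantumAdvantage.QuantumAdvantage.Theorems.MobiusLadderQuadraticDigitPhasesStubEvalAddAdd

open Finset MvPolynomial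
open Summit.QuantumAdvantage.QuantumAdvantage.Theorems.MobiusLadderQuadraticDigitPhasesStubCompact

/-- The mixed second difference of the quadratic function
`Φ(x) = c + Σᵢ Σⱼ q i j · xᵢ xⱼ + Σᵢ lᵢ xᵢ` over `𝔽₂`:
`Φ(y + δ) + Φ(y) + Φ(δ) + Φ(0) = Σᵢ Σⱼ q i j · (yᵢ δⱼ + δᵢ yⱼ)`. -/
theorem second_difference_eq {n : ℕ} (c : ZMod 2) (q : Fin n → Fin n → ZMod 2) (l : Fin n → ZMod 2)
    (y δ : Fin n → ZMod 2) :
    c + ((∑ i, ∑ j, q i j * (y + δ) i * (y + δ) j) + ∑ i, l i * (y + δ) i) +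
        (c + ((∑ i, ∑ j, q i j * y i * y j) + ∑ i, l i * y i)) +
        (c + ((∑ i, ∑ j, q i j * δ i * δ j) + ∑ i, l i * δ i)) +
        (c + ((∑ i, ∑ j, q i j * (0 : Fin n → ZMod 2) i * (0 : Fin n → ZMod 2) j) +
          ∑ i, l i * (0 : Fin n → ZMod 2) i)) =
      ∑ i, ∑ j, q i j * (y i * δ j + δ i * y j) := by
  have h2 : (2 : ZMod 2) = 0 := by decide
  have hA : ∑ i, ∑ j, q i j * (y i * δ j + δ i * y j) =
      (∑ i, ∑ j, q i j * (y + δ) i * (y + δ) j) + (∑ i, ∑ j, q i j * y i * y j) +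
        ∑ i, ∑ j, q i j * δ i * δ j := by
    have e : ∀ i j, q i j * (y i * δ j + δ i * y j) =
        q i j * (y + δ) i * (y + δ) j + q i j * y i * y j + q i j * δ i * δ j := by
      intro i j
      simp only [Pi.add_apply]
      linear_combination (-(q i j * (y i * y j + δ i * δ j))) * h2
    simp only [e, Finset.sum_add_distrib]
  have hB : (∑ i, l i * (y + δ) i) + (∑ i, l i * y i) + ∑ i, l i * δ i = 0 := by
    rw [← Finset.sum_add_distrib, ← Finset.sum_add_distrib]
    refine Finset.sum_eq_zero fun i _ => ?_
    simp only [Pi.add_apply]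
    linear_combination (l i * (y i + δ i)) * h2
  simp only [Pi.zero_apply, mul_zero, Finset.sum_const_zero, add_zero]
  linear_combination (2 * c) * h2 + hB - hA

/-- STUB `stub_evalAddAdd`: for `P` of total degree `≤ 2` over `𝔽₂` and bit vectors `y, δ`,
`P(y + δ) + P(y) + P(δ) + P(0) = Σ_{i<j} a_{ij} (yᵢ δⱼ + δᵢ yⱼ)` with `a_{ij}` the coefficient of
`Xᵢ Xⱼ` in `P`. -/
theorem stub_evalAddAdd :
    ∀ (n : ℕ) (P : MvPolynomial (Fin n) (ZMod 2)), P.totalDegree ≤ 2 → ∀ y δ : Fin n → ZMod 2,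
      MvPolynomial.eval (y + δ) P + MvPolynomial.eval y P + MvPolynomial.eval δ P + MvPolynomial.eval 0 P =
        ∑ i : Fin n, ∑ j : Fin n, if i < j then
          MvPolynomial.coeff (Finsupp.single i 1 + Finsupp.single j 1) P * (y i * δ j + δ i * y j) else 0 := by
  intro n P hP y δ
  have hsq : ∀ a : ZMod 2, a * a = a := by decide
  rw [eval_eq_of_totalDegree_le_two P hP (y + δ) fun i => hsq _,
    eval_eq_of_totalDegree_le_two P hP y fun i => hsq _,
    eval_eq_of_totalDegree_le_two P hP δ fun i => hsq _,
    eval_eq_of_totalDegree_le_two P hP 0 fun i => hsq _,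
    second_difference_eq]
  refine Finset.sum_congr rfl fun i _ => Finset.sum_congr rfl fun j _ => ?_
  rw [ite_mul, zero_mul]

end Summit.QuantumAdvantage.QuantumAdvantage.Theorems.MobiusLadderQuadraticDigitPhasesStubEvalAddAdd
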